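import Literature.Combinatorics.Extremal.LinesOnTwoSurfaces
import Literature.Combinatorics.Extremal.LowDegreeSurfaceThroughLines
import Literature.RingTheory.MvPolynomial.RuppertReducibleProofs
import Mathlib.Algebra.MvPolynomial.PDeriv
import Mathlib.LinearAlgebra.CrossProduct
import HarnessLib

/-!
# Lines on a surface are tangent; the Guth–Katz critical-point lemma for two surfaces

Topic `Literature/Combinatorics/Extremal` (lines on algebraic surfaces). Everything in this file
is PROVED; it is the first-order ("critical point") layer of the Guth–Katz / Kollár analysis of
lines on the intersection of two surfaces in `K³`.

* `coeff_one_aeval_line` — first-order Taylor coefficient of the restriction of a polynomial to a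
  parametrized line: the `t`-coefficient of `P(a + t v)` is `∇P(a) · v` (`∇P = (∂₀P, ∂₁P, ∂₂P)`,
  Mathlib's `MvPolynomial.pderiv`).
* `grad_dotProduct_eq_zero_of_line` — if the line `{p + t v}` lies on `{f = 0}` then
  `∇f(p) · v = 0` (the line is tangent to the surface at each of its points).
* `cross_grad_eq_zero_of_two_lines` — **the critical-point lemma** [GuthKatz2010-style; cf.
  Guth–Katz, *Algebraic methods in discrete analogs of the Kakeya problem*, Adv. Math. 225 (2010),
  §4–5, and Kollár 2015, Prop. 14 (4) "points where either `S` or `T` is smooth"]: if two lines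
  through `p` with independent directions lie on both `{f = 0}` and `{g = 0}`, then
  `∇f(p) × ∇g(p) = 0` — both gradients are orthogonal to the plane of the two lines, hence
  parallel; i.e. `p` is a singular point of the complete intersection `{f = g = 0}`.
* `card_le_of_cross_grad_ne_zero` — **non-critical lines carry few crossing points**: if a line
  `ℓ ⊂ {f = 0} ∩ {g = 0}` is not contained in `{(∇f × ∇g)ᵢ = 0}` for some component `i`, then at
  most `deg f + deg g - 2` points of `ℓ` lie on another line of `{f = 0} ∩ {g = 0}` (the
  component restricted to `ℓ` is a non-zero polynomial of degree `≤ (deg f - 1) + (deg g - 1)`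
  vanishing at every such point).

These are stated for polynomials over a field `K` (infinite where a polynomial is recovered from
its values). They are the elementary half of the count of intersection points of lines on
`S ∩ T` (the other half — lines along which `S` and `T` are tangent — needs the arithmetic genus,
[Kollar2015, Prop. 14 (2)], or a descent on the multiplicity).

## References
* L. Guth, N. H. Katz, *Algebraic methods in discrete analogs of the Kakeya problem*, Adv. Math.
  225 (2010) 2828–2839 — critical points and lines on `Z(f) ∩ Z(g)`. [folklore rendering]
* [Kollar2015] J. Kollár, *Szemerédi–Trotter-type theorems in dimension 3*, Adv. Math. 271
  (2015), Proposition 14.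
-/

namespace Literature.Combinatorics.Extremal

open MvPolynomial Finset
open scoped Matrix
open Literature.RingTheory.MvPolynomial.Ruppert (totalDegree_pderiv_le)

/-! ### First-order Taylor coefficient along a line -/

section Taylor

variable {K : Type*} [CommRing K] {σ : Type*}

/-- The constant coefficient of the restriction `P(a + t v)` is `P(a)`. [folklore] -/
theorem coeff_zero_aeval_line (a v : σ → K) (P : MvPolynomial σ K) :
    (aeval (fun i => Polynomial.C (a i) + Polynomial.C (v i) * Polynomial.X) P).coeff 0 =
      eval a P := by
  rw [Polynomial.coeff_zero_eq_eval_zero, eval_aeval_line, zero_smul, add_zero]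

/-- **First-order Taylor coefficient along a line**: the `t`-coefficient of `P(a + t v)` is
`Σᵢ vᵢ ∂ᵢP(a)`. [folklore] -/
theorem coeff_one_aeval_line [Fintype σ] [DecidableEq σ] (a v : σ → K) (P : MvPolynomial σ K) :
    (aeval (fun i => Polynomial.C (a i) + Polynomial.C (v i) * Polynomial.X) P).coeff 1 =
      ∑ i, v i * eval a (pderiv i P) := by
  induction P using MvPolynomial.induction_on with
  | C c =>
    simp only [aeval_C, Polynomial.algebraMap_eq, Polynomial.coeff_C_succ, pderiv_C, map_zero,
      mul_zero, Finset.sum_const_zero]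
  | add p q hp hq =>
    simp only [map_add, Polynomial.coeff_add, hp, hq, mul_add, Finset.sum_add_distrib]
  | mul_X p j hp =>
    have h0 := coeff_zero_aeval_line a v p
    rw [map_mul, aeval_X, mul_add, Polynomial.coeff_add, Polynomial.coeff_mul_C, hp, ← mul_assoc,
      Polynomial.coeff_mul_X, Polynomial.coeff_mul_C, h0]
    simp only [pderiv_mul, map_add, map_mul, eval_X, pderiv_X, mul_add, Finset.sum_add_distrib]
    congr 1
    · rw [Finset.sum_mul]
      exact Finset.sum_congr rfl fun i _ => by ring
    · rw [Finset.sum_eq_single j]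
      · simp
        ring
      · intro i _ hij
        simp [Ne.symm hij]
      · intro hj
        exact absurd (Finset.mem_univ j) hj

end Taylor

/-! ### Lines on a surface are tangent; the critical-point lemma -/

section Tangent

variable {K : Type*} [Field K]

/-- **A line on a surface is tangent to it**: if `f(p + t v) = 0` for all `t` (`K` infinite), then
`∇f(p) · v = 0`. [folklore] -/
theorem grad_dotProduct_eq_zero_of_line [Infinite K] {f : MvPolynomial (Fin 3) K}
    (p v : Fin 3 → K) (h : ∀ t : K, eval (p + t • v) f = 0) :
    (fun i => eval p (pderiv i f)) ⬝ᵥ v = 0 := by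
  classical
  have h0 : aeval (fun i => Polynomial.C (p i) + Polynomial.C (v i) * Polynomial.X) f = 0 :=
    Polynomial.funext fun t => by rw [eval_aeval_line, h t, Polynomial.eval_zero]
  have h1 := coeff_one_aeval_line p v f
  rw [h0, Polynomial.coeff_zero] at h1
  rw [dotProduct, h1]
  exact Finset.sum_congr rfl fun i _ => mul_comm _ _

/-- **The Guth–Katz critical-point lemma.** If two lines through `p` with linearly independent
directions `v, v'` lie on `{f = 0}` and on `{g = 0}` (`K` infinite), then
`∇f(p) × ∇g(p) = 0`: both gradients are orthogonal to `v` and `v'`, hence multiples of `v × v'`.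
(So a point where two lines of `{f = 0} ∩ {g = 0}` cross is a singular point of the complete
intersection.) [folklore] -/
theorem cross_grad_eq_zero_of_two_lines [Infinite K] {f g : MvPolynomial (Fin 3) K}
    (p v v' : Fin 3 → K) (hind : LinearIndependent K ![v, v'])
    (hfv : ∀ t : K, eval (p + t • v) f = 0) (hfv' : ∀ t : K, eval (p + t • v') f = 0)
    (hgv : ∀ t : K, eval (p + t • v) g = 0) (hgv' : ∀ t : K, eval (p + t • v') g = 0) :
    (fun i => eval p (pderiv i f)) ⨯₃ (fun i => eval p (pderiv i g)) = 0 := by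
  set n := v ⨯₃ v' with hn
  have hn0 : n ≠ 0 := crossProduct_ne_zero_iff_linearIndependent.2 hind
  -- vectors orthogonal to `v` and `v'` are multiples of `n = v × v'`
  have key : ∀ x : Fin 3 → K, x ⬝ᵥ v = 0 → x ⬝ᵥ v' = 0 → ∃ s : K, x = s • n := by
    intro x hxv hxv'
    have hnx : n ⨯₃ x = 0 := by
      rw [hn, cross_cross_eq_smul_sub_smul, dotProduct_comm v x, dotProduct_comm v' x, hxv, hxv',
        zero_smul, zero_smul, sub_zero]
    refine exists_eq_smul_of_not_linearIndependent hn0 fun hind' => ?_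
    exact (crossProduct_ne_zero_iff_linearIndependent.2 hind') hnx
  obtain ⟨s, hs⟩ := key _ (grad_dotProduct_eq_zero_of_line p v hfv)
    (grad_dotProduct_eq_zero_of_line p v' hfv')
  obtain ⟨t, ht⟩ := key _ (grad_dotProduct_eq_zero_of_line p v hgv)
    (grad_dotProduct_eq_zero_of_line p v' hgv')
  rw [hs, ht, LinearMap.map_smul₂, LinearMap.map_smul, cross_self, smul_zero, smul_zero]

/-- Evaluating the polynomial vector field `∇f × ∇g` at a point. [folklore] -/
theorem eval_crossProduct_grad (f g : MvPolynomial (Fin 3) K) (z : Fin 3 → K) (i : Fin 3) :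
    eval z (((fun j => pderiv j f) ⨯₃ (fun j => pderiv j g)) i) =
      ((fun j => eval z (pderiv j f)) ⨯₃ (fun j => eval z (pderiv j g))) i := by
  fin_cases i <;> simp [cross_apply]

/-- The components of `∇f × ∇g` have total degree `≤ (deg f - 1) + (deg g - 1)`. [folklore] -/
theorem totalDegree_crossProduct_grad_le (f g : MvPolynomial (Fin 3) K) (i : Fin 3) :
    (((fun j => pderiv j f) ⨯₃ (fun j => pderiv j g)) i).totalDegree ≤
      (f.totalDegree - 1) + (g.totalDegree - 1) := by
  have hmul : ∀ j k, (pderiv j f * pderiv k g).totalDegree ≤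
      (f.totalDegree - 1) + (g.totalDegree - 1) := fun j k =>
    (totalDegree_mul _ _).trans (Nat.add_le_add (totalDegree_pderiv_le j f)
      (totalDegree_pderiv_le k g))
  have hsub : ∀ j k j' k', (pderiv j f * pderiv k g - pderiv j' f * pderiv k' g).totalDegree ≤
      (f.totalDegree - 1) + (g.totalDegree - 1) := fun j k j' k' =>
    (totalDegree_sub _ _).trans (max_le (hmul j k) (hmul j' k'))
  fin_cases i <;> simpa [cross_apply] using hsub _ _ _ _

/-- **Non-critical lines carry few crossing points.** Let the line `ℓ = {u + t w}` (`K`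
infinite) lie on `{f = 0}` and `{g = 0}`, and suppose some component `(∇f × ∇g)ᵢ` does not
vanish identically on `ℓ`. Then at most `deg f + deg g - 2` points of `ℓ` lie on another line of
`{f = 0} ∩ {g = 0}` (a line through the point with direction independent of `w`): at such a
point `∇f × ∇g = 0` (`cross_grad_eq_zero_of_two_lines`), and `(∇f × ∇g)ᵢ` restricted to `ℓ` is
a non-zero polynomial of degree `≤ (deg f - 1) + (deg g - 1)`. [folklore] -/
theorem card_le_of_cross_grad_ne_zero [Infinite K] {f g : MvPolynomial (Fin 3) K}
    (u w : Fin 3 → K) (i : Fin 3)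
    (hnc : ∃ t : K, eval (u + t • w) (((fun j => pderiv j f) ⨯₃ (fun j => pderiv j g)) i) ≠ 0)
    (hfl : ∀ t : K, eval (u + t • w) f = 0) (hgl : ∀ t : K, eval (u + t • w) g = 0)
    (P : Finset (Fin 3 → K))
    (hP : ∀ p ∈ P, (∃ t : K, p = u + t • w) ∧ ∃ v : Fin 3 → K, LinearIndependent K ![w, v] ∧
      (∀ t : K, eval (p + t • v) f = 0) ∧ (∀ t : K, eval (p + t • v) g = 0)) :
    P.card + 2 ≤ f.totalDegree + g.totalDegree := by
  classical
  set h := ((fun j => pderiv j f) ⨯₃ (fun j => pderiv j g)) i with hh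
  set H := aeval (fun j => Polynomial.C (u j) + Polynomial.C (w j) * Polynomial.X) h with hH
  have hH0 : H ≠ 0 := by
    obtain ⟨t, ht⟩ := hnc
    intro h0
    apply ht
    rw [← eval_aeval_line, ← hH, h0, Polynomial.eval_zero]
  -- `f` and `g` are not constant (otherwise `∇f × ∇g = 0`)
  have ha : 1 ≤ f.totalDegree := by
    by_contra hlt
    push Not at hlt
    have hfC : f = C (coeff 0 f) := totalDegree_eq_zero_iff_eq_C.1 (by omega)
    apply hH0
    have hgrad : (fun j => pderiv j f) = 0 := by
      funext j
      rw [hfC, pderiv_C, Pi.zero_apply]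
    rw [hH, hh, hgrad, LinearMap.map_zero₂, Pi.zero_apply, map_zero]
  have hb : 1 ≤ g.totalDegree := by
    by_contra hlt
    push Not at hlt
    have hgC : g = C (coeff 0 g) := totalDegree_eq_zero_iff_eq_C.1 (by omega)
    apply hH0
    have hgrad : (fun j => pderiv j g) = 0 := by
      funext j
      rw [hgC, pderiv_C, Pi.zero_apply]
    rw [hH, hh, hgrad, LinearMap.map_zero, Pi.zero_apply, map_zero]
  -- parameters of the points of `P`, all roots of `H`
  choose! tP htP using fun p (hp : p ∈ P) => (hP p hp).1
  have hroot : ∀ p ∈ P, H.eval (tP p) = 0 := by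
    intro p hp
    obtain ⟨-, v, hind, hfv, hgv⟩ := hP p hp
    have hfw : ∀ t : K, eval (p + t • w) f = 0 := fun t => by
      rw [htP p hp, add_assoc, ← add_smul]; exact hfl _
    have hgw : ∀ t : K, eval (p + t • w) g = 0 := fun t => by
      rw [htP p hp, add_assoc, ← add_smul]; exact hgl _
    rw [hH, eval_aeval_line, ← htP p hp, hh, eval_crossProduct_grad,
      cross_grad_eq_zero_of_two_lines p w v hind hfw hfv hgw hgv, Pi.zero_apply]
  have hinj : Set.InjOn tP ↑P := fun p hp q hq heq => by
    rw [htP p hp, htP q hq, heq]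
  have hsub : P.image tP ⊆ H.roots.toFinset := by
    intro t ht
    rw [Multiset.mem_toFinset, Polynomial.mem_roots hH0]
    obtain ⟨p, hp, rfl⟩ := Finset.mem_image.1 ht
    exact hroot p hp
  have hcard : P.card ≤ (f.totalDegree - 1) + (g.totalDegree - 1) :=
    calc P.card = (P.image tP).card := (Finset.card_image_of_injOn hinj).symm
      _ ≤ H.roots.toFinset.card := Finset.card_le_card hsub
      _ ≤ H.roots.card := Multiset.toFinset_card_le _
      _ ≤ H.natDegree := Polynomial.card_roots' H
      _ ≤ h.totalDegree := natDegree_aeval_line_le u w h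
      _ ≤ (f.totalDegree - 1) + (g.totalDegree - 1) := totalDegree_crossProduct_grad_le f g i
  omega

end Tangent

/-! ### Singular lines: lines of `{f = 0}` inside `{∂ᵢ f = 0}` -/

section SingularLines

variable {K : Type*} [Field K]

/-- In characteristic `0`, or in characteristic `p > d`, the integers `1, …, d` are non-zero in
`K`. [folklore] -/
theorem natCast_ne_zero_of_ringChar {d : ℕ} (h : ringChar K = 0 ∨ d < ringChar K) :
    ∀ a : ℕ, 0 < a → a ≤ d → (a : K) ≠ 0 := by
  intro a ha had h0
  have hdvd : ringChar K ∣ a := (ringChar.spec K a).1 h0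
  rcases h with h | h
  · rw [h, zero_dvd_iff] at hdvd
    omega
  · exact absurd (Nat.le_of_dvd ha hdvd) (by omega)

/-- **A non-constant polynomial of degree `≤ d` has a non-zero partial derivative** when
`1, …, d` are non-zero in `K` (look at a monomial of top degree). [folklore] -/
theorem exists_pderiv_ne_zero {σ : Type*} {p : MvPolynomial σ K} {d : ℕ}
    (hchar : ∀ a : ℕ, 0 < a → a ≤ d → (a : K) ≠ 0) (hpos : 0 < p.totalDegree)
    (hdeg : p.totalDegree ≤ d) : ∃ i, pderiv i p ≠ 0 := by
  classical
  have hne : p.support.Nonempty := by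
    rw [Finset.nonempty_iff_ne_empty, Ne, support_eq_empty]
    rintro rfl
    simp at hpos
  obtain ⟨m, hm, hmax⟩ := Finset.exists_mem_eq_sup p.support hne (fun s => s.sum fun _ e => e)
  change p.totalDegree = m.sum (fun _ e => e) at hmax
  have hcoeff : coeff m p ≠ 0 := mem_support_iff.mp hm
  -- some exponent of `m` is positive
  obtain ⟨i, hi⟩ : ∃ i, 0 < m i := by
    by_contra hall
    push Not at hall
    have : (m.sum fun _ e => e) = 0 := Finset.sum_eq_zero fun i _ => Nat.le_zero.1 (hall i)
    omega
  refine ⟨i, fun hzero => ?_⟩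
  have h := congrArg (coeff (m - Finsupp.single i 1)) hzero
  rw [coeff_pderiv, coeff_zero, tsub_add_cancel_of_le (Finsupp.single_le_iff.mpr hi)] at h
  refine mul_ne_zero hcoeff ?_ h
  have hmi : ((m - Finsupp.single i 1 : σ →₀ ℕ) i + 1 : ℕ) = m i := by
    simp only [Finsupp.tsub_apply, Finsupp.single_eq_same]; omega
  have hle : m i ≤ d := by
    have : m i ≤ m.sum fun _ e => e := by
      by_cases hmem : i ∈ m.support
      · exact Finset.single_le_sum (fun j _ => Nat.zero_le (m j)) hmem
      · rw [Finsupp.notMem_support_iff.1 hmem]; exact Nat.zero_le _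
    omega
  exact_mod_cast hchar _ (by omega) (by omega : ((m - Finsupp.single i 1 : σ →₀ ℕ) i + 1) ≤ d)

/-- **At most `d(d-1)` lines of an irreducible surface lie in `{∂ᵢ f = 0}`** (in particular, at
most `d(d-1)` lines of `{f = 0}` consist of singular points), provided `∂ᵢ f ≠ 0`: `f` is
irreducible of degree `d` and does not divide `∂ᵢ f` (degree `d - 1`), so
`card_lines_on_two_surfaces_le` applies. (Guth–Katz's "critical lines" count.)
[cite: Kollar2015, Proposition 14 (1)] -/
theorem card_lines_on_surface_and_pderiv_le [Infinite K] {f : MvPolynomial (Fin 3) K}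
    (hf : Irreducible f) (i : Fin 3) (hi : pderiv i f ≠ 0)
    (Λ : Finset (AffineSubspace K (Fin 3 → K)))
    (hΛ1 : ∀ ℓ ∈ Λ, Module.finrank K ℓ.direction = 1)
    (hΛf : ∀ ℓ ∈ Λ, ∀ z ∈ ℓ, eval z f = 0)
    (hΛi : ∀ ℓ ∈ Λ, ∀ z ∈ ℓ, eval z (pderiv i f) = 0) :
    Λ.card ≤ f.totalDegree * (f.totalDegree - 1) := by
  have hf0 : f ≠ 0 := hf.ne_zero
  have hpos : 0 < f.totalDegree := by
    by_contra h0
    push Not at h0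
    have hfC : f = C (coeff 0 f) := totalDegree_eq_zero_iff_eq_C.1 (Nat.le_zero.1 h0)
    refine hf.not_isUnit ?_
    rw [hfC]
    refine MvPolynomial.isUnit_iff_eq_C_of_isReduced.2 ⟨coeff 0 f, ?_, rfl⟩
    exact isUnit_iff_ne_zero.2 fun hc => hf0 (by rw [hfC, hc, C_0])
  have hrel : IsRelPrime f (pderiv i f) := by
    refine hf.isRelPrime_iff_not_dvd.2 fun hdvd => ?_
    have h1 := totalDegree_le_of_dvd_of_isDomain hdvd hi
    have h2 := totalDegree_pderiv_le i f
    omega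
  exact (card_lines_on_two_surfaces_le hrel Λ hΛ1 hΛf hΛi).trans
    (Nat.mul_le_mul_left _ (totalDegree_pderiv_le i f))

end SingularLines

end Literature.Combinatorics.Extremal
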